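import Literature.NumberTheory.NumberFields.CyclicQuinticField2651K2Units
import HarnessLib

/-!
# The cyclic quintic field of conductor `2651`, number `2`: the quotient `𝓞 K/4` and the finite checks

Continuation of `CyclicQuinticField2651K2Units.lean` (`K = CyclicQuintic2651K2.K`, `(2)` inert, units
`rep n` modulo squares). As in the tree's `CyclicQuinticField11Model.lean`, the `2`-adic part of the
`2`-descent of `480a1 : y² = x(x+2)(x-3)` over `K` only needs the finite ring
**`Q4 = 𝓞 K/4 = TAlg spec (ℤ/4)`** (the reduction `red4 : 𝓞 K → Q4` of the Units file) and three
finite checks, evaluated by the kernel: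

* `oddSq4`/`sq4`: the `31` squares of units and the `32` squares of `Q4`, complete (`sq_mem_oddSq4`,
  `sq_mem_sq4`, by `decide` over the `1024` elements); `IsOdd u ↔ red42 u ≠ 0`; `isOdd_of_not_two_dvd`;
* `repQ n` (the image of `rep n`: products of the reductions `redvTab i` of `σⁱ v`), `repQinv n`,
  the fifteen candidates `candN` (non-zero `n` with even weight (`N v = -1`): the non-trivial unit classes of norm
  `+1`), `mem_candN`;
* `closure_check`, `cand_check`, `main_check` and their propositional forms `no_solution_neg`
  (`uS ≠ S'`) and `no_solution_main` (`uS + 2 = S'`, `uS - 3 = uS''` impossible), verbatim the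
  conductor-`11` file. [folklore]

## References

* J. H. Silverman, *The Arithmetic of Elliptic Curves*, 2nd ed., GTM 106 (2009), Ch. X §1, Prop. X.1.4,
  Example X.1.5. [folklore]
* T. Dokchitser, V. Dokchitser, J. Number Theory 131 (2011) 1833–1839, proof of Thm. 2. [DokchitserDokchitser2011RankModN]
-/

noncomputable section

open NumberField

namespace Literature.NumberTheory.NumberFields

namespace CyclicQuintic2651K2

/-! ### `Q4 = 𝓞 K/4` and oddness -/

/-- **`Q4 = 𝓞 K/4 = R/4R`.** [folklore] -/
abbrev Q4 : Type := TAlg spec (ZMod 4)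

/-- `4 = 0` in `Q4`. [folklore] -/
theorem four_eq_zero : (4 : Q4) = 0 := by decide +kernel

/-- **Fast multiplication of `Q4`** (the table reduced modulo `4`, zero entries dropped), for kernel
evaluation of the finite checks. [folklore] -/
def mulQ (u v : Q4) : Q4 :=
  ⟨![2 * (u.coef 0 * v.coef 0) + 2 * (u.coef 0 * v.coef 2) + 3 * (u.coef 0 * v.coef 3) + 2 * (u.coef 0 * v.coef 4) + (u.coef 1 * v.coef 2) + 2 * (u.coef 1 * v.coef 3) + (u.coef 1 * v.coef 4) + 2 * (u.coef 2 * v.coef 0) + (u.coef 2 * v.coef 1) + (u.coef 2 * v.coef 2) + 2 * (u.coef 2 * v.coef 3) + 2 * (u.coef 2 * v.coef 4) + 3 * (u.coef 3 * v.coef 0) + 2 * (u.coef 3 * v.coef 1) + 2 * (u.coef 3 * v.coef 2) + (u.coef 3 * v.coef 4) + 2 * (u.coef 4 * v.coef 0) + (u.coef 4 * v.coef 1) + 2 * (u.coef 4 * v.coef 2) + (u.coef 4 * v.coef 3) + 2 * (u.coef 4 * v.coef 4),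
    2 * (u.coef 0 * v.coef 0) + 2 * (u.coef 0 * v.coef 1) + (u.coef 0 * v.coef 2) + 2 * (u.coef 0 * v.coef 3) + (u.coef 0 * v.coef 4) + 2 * (u.coef 1 * v.coef 0) + 2 * (u.coef 1 * v.coef 1) + 2 * (u.coef 1 * v.coef 3) + 3 * (u.coef 1 * v.coef 4) + (u.coef 2 * v.coef 0) + (u.coef 2 * v.coef 3) + 2 * (u.coef 2 * v.coef 4) + 2 * (u.coef 3 * v.coef 0) + 2 * (u.coef 3 * v.coef 1) + (u.coef 3 * v.coef 2) + (u.coef 3 * v.coef 3) + 2 * (u.coef 3 * v.coef 4) + (u.coef 4 * v.coef 0) + 3 * (u.coef 4 * v.coef 1) + 2 * (u.coef 4 * v.coef 2) + 2 * (u.coef 4 * v.coef 3),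
    (u.coef 0 * v.coef 1) + 3 * (u.coef 0 * v.coef 2) + 2 * (u.coef 0 * v.coef 3) + 2 * (u.coef 0 * v.coef 4) + (u.coef 1 * v.coef 0) + 2 * (u.coef 1 * v.coef 1) + 2 * (u.coef 1 * v.coef 2) + (u.coef 1 * v.coef 3) + 2 * (u.coef 1 * v.coef 4) + 3 * (u.coef 2 * v.coef 0) + 2 * (u.coef 2 * v.coef 1) + 2 * (u.coef 2 * v.coef 2) + 2 * (u.coef 2 * v.coef 4) + 2 * (u.coef 3 * v.coef 0) + (u.coef 3 * v.coef 1) + (u.coef 3 * v.coef 4) + 2 * (u.coef 4 * v.coef 0) + 2 * (u.coef 4 * v.coef 1) + 2 * (u.coef 4 * v.coef 2) + (u.coef 4 * v.coef 3) + (u.coef 4 * v.coef 4),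
    (u.coef 0 * v.coef 0) + 2 * (u.coef 0 * v.coef 1) + 2 * (u.coef 0 * v.coef 2) + 2 * (u.coef 0 * v.coef 3) + (u.coef 0 * v.coef 4) + 2 * (u.coef 1 * v.coef 0) + (u.coef 1 * v.coef 2) + 3 * (u.coef 1 * v.coef 3) + 2 * (u.coef 1 * v.coef 4) + 2 * (u.coef 2 * v.coef 0) + (u.coef 2 * v.coef 1) + 2 * (u.coef 2 * v.coef 2) + 2 * (u.coef 2 * v.coef 3) + (u.coef 2 * v.coef 4) + 2 * (u.coef 3 * v.coef 0) + 3 * (u.coef 3 * v.coef 1) + 2 * (u.coef 3 * v.coef 2) + 2 * (u.coef 3 * v.coef 3) + (u.coef 4 * v.coef 0) + 2 * (u.coef 4 * v.coef 1) + (u.coef 4 * v.coef 2),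
    (u.coef 0 * v.coef 1) + 2 * (u.coef 0 * v.coef 2) + (u.coef 0 * v.coef 3) + (u.coef 1 * v.coef 0) + (u.coef 1 * v.coef 1) + 2 * (u.coef 1 * v.coef 2) + 2 * (u.coef 1 * v.coef 3) + 2 * (u.coef 1 * v.coef 4) + 2 * (u.coef 2 * v.coef 0) + 2 * (u.coef 2 * v.coef 1) + (u.coef 2 * v.coef 3) + 3 * (u.coef 2 * v.coef 4) + (u.coef 3 * v.coef 0) + 2 * (u.coef 3 * v.coef 1) + (u.coef 3 * v.coef 2) + 2 * (u.coef 3 * v.coef 3) + 2 * (u.coef 3 * v.coef 4) + 2 * (u.coef 4 * v.coef 1) + 3 * (u.coef 4 * v.coef 2) + 2 * (u.coef 4 * v.coef 3) + 2 * (u.coef 4 * v.coef 4)]⟩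

/-- `mulQ` is the multiplication of `Q4`. [folklore] -/
theorem mulQ_eq (u v : Q4) : mulQ u v = u * v := by
  ext d
  rw [TAlg.mul_coef]
  fin_cases d <;>
  · simp only [mulQ, spec, Fin.sum_univ_five, Fin.isValue, Matrix.cons_val_zero, Matrix.cons_val_one, Matrix.head_cons,
      Matrix.cons_val_two, Matrix.tail_cons, Matrix.cons_val_three, Matrix.cons_val_four,
      Fin.zero_eta, Fin.mk_one, Fin.reduceFinMk, show ((-118 : ℤ) : ZMod 4) = 2 by decide, show ((-114 : ℤ) : ZMod 4) = 2 by decide, show ((-108 : ℤ) : ZMod 4) = 0 by decide, show ((-105 : ℤ) : ZMod 4) = 3 by decide, show ((-103 : ℤ) : ZMod 4) = 1 by decide, show ((-102 : ℤ) : ZMod 4) = 2 by decide, show ((412 : ℤ) : ZMod 4) = 0 by decide, show ((416 : ℤ) : ZMod 4) = 0 by decide, show ((422 : ℤ) : ZMod 4) = 2 by decide, show ((425 : ℤ) : ZMod 4) = 1 by decide, show ((446 : ℤ) : ZMod 4) = 2 by decide]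
    ring

/-- `x³⁰` by repeated squaring with `mulQ`. [folklore] -/
def powQ30 (x : Q4) : Q4 :=
  let x2 := mulQ x x
  let x4 := mulQ x2 x2
  let x8 := mulQ x4 x4
  let x16 := mulQ x8 x8
  mulQ (mulQ (mulQ x16 x8) x4) x2

/-- `powQ30 x = x³⁰`. [folklore] -/
theorem powQ30_eq (x : Q4) : powQ30 x = x ^ 30 := by
  simp only [powQ30, mulQ_eq]; ring

/-- **Odd elements of `Q4`**: non-zero image in `R/2R = 𝔽₃₂` (these are exactly the units). [folklore] -/
def IsOdd (u : Q4) : Prop := red42 u ≠ 0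

/-- Oddness is decidable. [folklore] -/
instance : DecidablePred IsOdd := fun u => by unfold IsOdd; infer_instance

/-- **Elements of `𝓞 K` not divisible by `2` reduce to odd elements** (the kernel of
`red42 ∘ red4 : 𝓞 K → 𝔽₃₂` is `(2)`). [folklore] -/
theorem isOdd_of_not_two_dvd {z : 𝓞 K} (hz : ¬ (2 : 𝓞 K) ∣ z) : IsOdd (red4 z) := by
  intro h0
  apply hz
  -- `red4 z` reduces to `0` modulo `2`: `red4 z = 2 w`, lift to `𝓞 K`
  obtain ⟨w, hw⟩ := exists_eq_two_mul_of_red42_eq_zero h0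
  -- `integerEquiv.symm z - 2 (lift w) ∈ ker (red 4) = 4R`
  set y := integerEquiv.symm z with hy
  have hz' : z = integerEquiv y := (integerEquiv.apply_symm_apply z).symm
  obtain ⟨w', hw'⟩ : ∃ w' : R, red 4 w' = w := ⟨⟨fun a => ((w.coef a).val : ℤ)⟩, by ext a; simp [red]⟩
  have h4 : red 4 (y - 2 * w') = 0 := by
    rw [map_sub, map_mul, hw', map_ofNat, ← hw]
    show red4 z - red 4 y = 0
    rw [hz', show red4 (integerEquiv y) = red 4 y from red4_liftO y, sub_self]
  obtain ⟨t, ht⟩ := TAlg.exists_eq_natCast_mul_of_map_eq_zero 4 h4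
  refine ⟨integerEquiv (w' + 2 * t), ?_⟩
  rw [hz', ← map_ofNat integerEquiv 2, ← map_mul]
  congr 1
  have : y = 2 * w' + 4 * t := by
    have h' := ht
    push_cast at h'
    linear_combination h'
  rw [this]; ring

/-! ### The squares of `Q4` -/

/-- The `31` squares of odd elements (units) of `Q4`. [folklore] -/
def oddSq4 : List Q4 := [⟨![0, 0, 1, 3, 2]⟩, ⟨![0, 0, 3, 0, 3]⟩, ⟨![0, 1, 0, 2, 2]⟩, ⟨![0, 1, 2, 1, 3]⟩, ⟨![0, 1, 3, 1, 2]⟩, ⟨![0, 1, 3, 2, 0]⟩, ⟨![0, 2, 2, 0, 1]⟩, ⟨![0, 3, 0, 0, 3]⟩, ⟨![0, 3, 0, 3, 0]⟩, ⟨![1, 0, 2, 2, 0]⟩, ⟨![1, 1, 1, 1, 1]⟩, ⟨![1, 1, 3, 1, 2]⟩, ⟨![1, 2, 0, 1, 3]⟩, ⟨![1, 2, 1, 1, 3]⟩, ⟨![1, 2, 1, 3, 0]⟩, ⟨![1, 3, 0, 1, 2]⟩, ⟨![1, 3, 1, 2, 0]⟩, ⟨![1, 3, 1, 2, 1]⟩,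 ⟨![1, 3, 2, 0, 0]⟩, ⟨![2, 0, 0, 1, 3]⟩, ⟨![2, 0, 1, 0, 2]⟩, ⟨![2, 0, 1, 3, 1]⟩, ⟨![2, 1, 1, 3, 1]⟩, ⟨![2, 1, 3, 0, 1]⟩, ⟨![2, 2, 0, 1, 0]⟩, ⟨![3, 0, 0, 3, 0]⟩, ⟨![3, 0, 1, 2, 1]⟩, ⟨![3, 0, 3, 0, 0]⟩, ⟨![3, 1, 2, 0, 1]⟩, ⟨![3, 1, 2, 1, 1]⟩, ⟨![3, 2, 0, 0, 1]⟩]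

/-- The `32` squares of `Q4`. [folklore] -/
def sq4 : List Q4 := [⟨![0, 0, 0, 0, 0]⟩, ⟨![0, 0, 1, 3, 2]⟩, ⟨![0, 0, 3, 0, 3]⟩, ⟨![0, 1, 0, 2, 2]⟩, ⟨![0, 1, 2, 1, 3]⟩, ⟨![0, 1, 3, 1, 2]⟩, ⟨![0, 1, 3, 2, 0]⟩, ⟨![0, 2, 2, 0, 1]⟩, ⟨![0, 3, 0, 0, 3]⟩, ⟨![0, 3, 0, 3, 0]⟩, ⟨![1, 0, 2, 2, 0]⟩, ⟨![1, 1, 1, 1, 1]⟩, ⟨![1, 1, 3, 1, 2]⟩, ⟨![1, 2, 0, 1, 3]⟩, ⟨![1, 2, 1, 1, 3]⟩, ⟨![1, 2, 1, 3, 0]⟩, ⟨![1, 3, 0, 1, 2]⟩, ⟨![1, 3, 1, 2, 0]⟩, ⟨![1, 3, 1, 2, 1]⟩, ⟨![1, 3, 2, 0, 0]⟩, ⟨![2, 0, 0, 1, 3]⟩, ⟨![2, 0, 1, 0, 2]⟩, ⟨![2, 0, 1, 3, 1]⟩, ⟨![2, 1, 1, 3, 1]⟩, ⟨![2, 1, 3,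 0, 1]⟩, ⟨![2, 2, 0, 1, 0]⟩, ⟨![3, 0, 0, 3, 0]⟩, ⟨![3, 0, 1, 2, 1]⟩, ⟨![3, 0, 3, 0, 0]⟩, ⟨![3, 1, 2, 0, 1]⟩, ⟨![3, 1, 2, 1, 1]⟩, ⟨![3, 2, 0, 0, 1]⟩]

set_option maxRecDepth 100000 in
set_option maxHeartbeats 0 in
/-- **The square of an odd element is in `oddSq4`** (kernel computation over `Q4`). [folklore] -/
theorem sq_mem_oddSq4 (u : Q4) (hu : IsOdd u) : u * u ∈ oddSq4 := by
  have h : ∀ u : Q4, IsOdd u → mulQ u u ∈ oddSq4 := by decide +kernel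
  rw [← mulQ_eq]; exact h u hu

set_option maxRecDepth 100000 in
set_option maxHeartbeats 0 in
/-- **Every square of `Q4` is in `sq4`** (kernel computation). [folklore] -/
theorem sq_mem_sq4 (u : Q4) : u * u ∈ sq4 := by
  have h : ∀ u : Q4, mulQ u u ∈ sq4 := by decide +kernel
  rw [← mulQ_eq]; exact h u

/-! ### The images of the units and the candidate classes -/

/-- The reductions of the conjugate units `σⁱ v` modulo `4`. [folklore] -/
def redvTab : Fin 5 → Q4 := ![⟨![3, 0, 0, 0, 3]⟩, ⟨![3, 3, 0, 0, 0]⟩, ⟨![0, 3, 3, 0, 0]⟩, ⟨![0, 0, 3, 3, 0]⟩, ⟨![0, 0, 0, 3, 3]⟩]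

/-- The reductions of the inverses `(σⁱ v)⁻¹` modulo `4`. [folklore] -/
def redvinvTab : Fin 5 → Q4 := ![⟨![3, 3, 3, 1, 2]⟩, ⟨![2, 3, 3, 3, 1]⟩, ⟨![1, 2, 3, 3, 3]⟩, ⟨![3, 1, 2, 3, 3]⟩, ⟨![3, 3, 1, 2, 3]⟩]

/-- `red 4 (shiftⁱ v) = redvTab i` (kernel computation). [folklore] -/
theorem red_shift_iterate_vP : ∀ i : Fin 5, red 4 (shift^[(i : ℕ)] vP) = redvTab i := by
  decide +kernel

/-- The image of `rep n` in `Q4` (explicit product, for kernel evaluation). [folklore] -/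
def repQ (n : Fin 32) : Q4 :=
  (-1) ^ bit n 4 * (redvTab 0 ^ bit n 0 * redvTab 1 ^ bit n 1 * redvTab 2 ^ bit n 2 * redvTab 3 ^ bit n 3)

/-- The image of `(rep n)⁻¹`. [folklore] -/
def repQinv (n : Fin 32) : Q4 :=
  (-1) ^ bit n 4 * (redvinvTab 0 ^ bit n 0 * redvinvTab 1 ^ bit n 1 * redvinvTab 2 ^ bit n 2 * redvinvTab 3 ^ bit n 3)

/-- **`red4 (rep n) = repQ n`.** [folklore] -/
theorem red4_rep (n : Fin 32) : red4 ((rep n : (𝓞 K)ˣ) : 𝓞 K) = repQ n := by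
  rw [rep, Units.val_mul, Units.val_pow_eq_pow_val, Units.val_neg, Units.val_one, map_mul, map_pow, map_neg, map_one,
    Units.coe_prod, map_prod, repQ, Fin.prod_univ_four]
  simp only [Units.val_pow_eq_pow_val, map_pow, coe_unitv, red4_liftO, Fin.castSucc_zero, Fin.castSucc_one,
    show (Fin.castSucc (2 : Fin 4) : Fin 5) = 2 from rfl, show (Fin.castSucc (3 : Fin 4) : Fin 5) = 3 from rfl,
    red_shift_iterate_vP]

/-- **The fifteen candidates**: the non-zero `n < 32` with even weight (`N v = -1`). [folklore] -/
def candN : List (Fin 32) := [3, 5, 6, 9, 10, 12, 15, 17, 18, 20, 23, 24, 27, 29, 30]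

/-- Every non-zero `n` satisfying the norm condition is a candidate (by computation). [folklore] -/
theorem mem_candN : ∀ n : Fin 32, n ≠ 0 → 2 ∣ bit n 0 + bit n 1 + bit n 2 + bit n 3 + bit n 4 → n ∈ candN := by
  decide +kernel

/-- The weight as a sum over `Fin 5`. [folklore] -/
theorem sum_bit_eq (n : Fin 32) : ∑ i, bit n i = bit n 0 + bit n 1 + bit n 2 + bit n 3 + bit n 4 := by
  rw [Fin.sum_univ_five]

/-! ### The three finite checks -/

set_option maxRecDepth 100000 in
set_option maxHeartbeats 0 in
/-- **`oddSq4` is a group**: closed under products and `S ↦ S³⁰ = S⁻¹` (kernel computation). [folklore] -/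
theorem closure_check :
    (oddSq4.all fun s => (mulQ s (powQ30 s) == 1) && List.elem (powQ30 s) oddSq4 &&
      oddSq4.all fun s' => List.elem (mulQ s s') oddSq4) = true := by
  decide +kernel

set_option maxRecDepth 100000 in
set_option maxHeartbeats 0 in
/-- **No candidate unit is an odd square modulo `4`**, and `repQinv n` is its inverse. [folklore] -/
theorem cand_check :
    (candN.all fun n => (mulQ (repQ n) (repQinv n) == 1) && !(List.elem (repQ n) oddSq4)) = true := by
  decide +kernel

set_option maxRecDepth 100000 in
set_option maxHeartbeats 0 in
/-- **The main check** (case `ord₂(x) = 0`): for `u = repQ n` and `S ∈ oddSq4`, if `uS + 2 ∈ oddSq4`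
then `S - 3u⁻¹ ∉ sq4`. [folklore] -/
theorem main_check :
    (candN.all fun n => oddSq4.all fun s =>
      !(List.elem (mulQ (repQ n) s + 2) oddSq4) || !(List.elem (s - mulQ 3 (repQinv n)) sq4)) = true := by
  decide +kernel

/-! ### Propositional forms -/

/-- `oddSq4` is closed under multiplication. [folklore] -/
theorem mul_mem_oddSq4 {s s' : Q4} (hs : s ∈ oddSq4) (hs' : s' ∈ oddSq4) : s * s' ∈ oddSq4 := by
  have h := closure_check
  simp only [List.all_eq_true, Bool.and_eq_true] at h
  rw [← mulQ_eq]
  exact List.mem_of_elem_eq_true ((h s hs).2 s' hs')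

/-- Inverses in `oddSq4`. [folklore] -/
theorem inv_mem_oddSq4 {s : Q4} (hs : s ∈ oddSq4) : s * s ^ 30 = 1 ∧ s ^ 30 ∈ oddSq4 := by
  have h := closure_check
  simp only [List.all_eq_true, Bool.and_eq_true, beq_iff_eq] at h
  rw [← powQ30_eq, ← mulQ_eq]
  exact ⟨(h s hs).1.1, List.mem_of_elem_eq_true (h s hs).1.2⟩

/-- For a candidate `n`: `repQ n · repQinv n = 1` and `repQ n ∉ oddSq4`. [folklore] -/
theorem cand_spec {n : Fin 32} (hn : n ∈ candN) : repQ n * repQinv n = 1 ∧ repQ n ∉ oddSq4 := by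
  have h := cand_check
  simp only [List.all_eq_true, Bool.and_eq_true, beq_iff_eq, Bool.not_eq_true'] at h
  rw [← mulQ_eq]
  refine ⟨(h n hn).1, fun hmem => ?_⟩
  have := List.elem_eq_true_of_mem hmem
  rw [(h n hn).2] at this
  exact Bool.false_ne_true this

/-- **Case `ord₂(x) < 0`**: `u · S ≠ S'` for a candidate `u` and odd squares `S, S'`. [folklore] -/
theorem no_solution_neg {n : Fin 32} (hn : n ∈ candN) {S S' : Q4} (hS : S ∈ oddSq4) (hS' : S' ∈ oddSq4) :
    repQ n * S ≠ S' := by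
  intro h
  obtain ⟨hinv, hmem⟩ := inv_mem_oddSq4 hS
  apply (cand_spec hn).2
  have e : repQ n = S' * S ^ 30 := by
    calc repQ n = repQ n * (S * S ^ 30) := by rw [hinv, mul_one]
      _ = repQ n * S * S ^ 30 := by ring
      _ = S' * S ^ 30 := by rw [h]
  rw [e]
  exact mul_mem_oddSq4 hS' hmem

/-- **Case `ord₂(x) = 0`**: `uS + 2 = S'` and `uS - 3 = uS''` have no solution with `S, S'` odd squares
and `S''` a square, for a candidate `u`. [folklore] -/
theorem no_solution_main {n : Fin 32} (hn : n ∈ candN) {S S' S'' : Q4} (hS : S ∈ oddSq4)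
    (hS' : S' ∈ oddSq4) (hS'' : S'' ∈ sq4) (h1 : repQ n * S + 2 = S')
    (h2 : repQ n * S - 3 = repQ n * S'') : False := by
  have h := main_check
  simp only [List.all_eq_true, Bool.or_eq_true, Bool.not_eq_true', mulQ_eq] at h
  have hinv := (cand_spec hn).1
  rcases h n hn S hS with h' | h'
  · have := List.elem_eq_true_of_mem (h1 ▸ hS' : repQ n * S + 2 ∈ oddSq4)
    rw [h'] at this
    exact Bool.false_ne_true this
  · have e : S - 3 * repQinv n = S'' := by
      calc S - 3 * repQinv n = repQinv n * repQ n * S - 3 * repQinv n := by rw [mul_comm (repQinv n), hinv, one_mul]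
        _ = repQinv n * (repQ n * S - 3) := by ring
        _ = repQinv n * (repQ n * S'') := by rw [h2]
        _ = repQinv n * repQ n * S'' := by ring
        _ = S'' := by rw [mul_comm (repQinv n), hinv, one_mul]
    have := List.elem_eq_true_of_mem (e ▸ hS'' : S - 3 * repQinv n ∈ sq4)
    rw [h'] at this
    exact Bool.false_ne_true this

end CyclicQuintic2651K2

end Literature.NumberTheory.NumberFields

end
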